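import Summits.CriticalPhenomena.SAWScalingLimit.Theorems.SAWDefectDecoherenceBoundaryClosureRInnerPolygonsHalfLattice
import Summits.CriticalPhenomena.SAWScalingLimit.Theorems.SAWDefectDecoherenceBoundaryClosureRInnerZigzagLevels
import HarnessLib

/-!
# Crux `BoundaryClosureR` (stmt-CriticalPhenomena-14004), line `polygon-parity-squeeze`,
# stub `stub_innerPolygonsOfZigzag` (7b): local charts of a zigzag polygon — geometry

Landing target:
`Summits/CriticalPhenomena/SAWScalingLimit/Theorems/SAWDefectDecoherenceBoundaryClosureRZigzagDiscretisationCharts.lean`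
(`--supports stmt-CriticalPhenomena-14004`; building block of the registered stub
`stub_innerPolygonsOfZigzag`, the lattice half of the inner-polygon construction (IP)).

The antecedent of `stub_innerPolygonsOfZigzag` describes the inner polygon `P` by LOCAL CHARTS: at a
frontier point `z` far from the corners `P ∩ ball z (r/2) = halfPlane k z ∩ ball z (r/2)`, at a corner
`c` the model is `halfPlane k c ∩ halfPlane k' c` or `halfPlane k c ∪ halfPlane k' c` inside
`ball c (2r)`.  This file collects the plane geometry of such charts (levels
`Re((w - z)·conj n_k)` against the six inner normals `n_k = innerNormal k`):

* `inner_innerNormal` — the table `Re(n_k · conj n_k') ∈ {±1, ±1/2}`, `cross_innerNormal` — the table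
  `Re(i n_k · conj n_k') ∈ {0, ±√3/2}`, and `inner_innerNormal_cases`;
* `eq_of_halfPlane_inter_ball_subset` — **chart uniqueness**: a half-ball of form `k` inside the
  half-plane of form `k'` through the same point forces `k = k'`;
* `abs_level_of_level_eq_zero` — on the line of form `k` through `c` the level of another,
  non-parallel form is `±(√3/2)·‖w - c‖`;
* `level_ge_or_of_ball_subset_union` — LEMMA U: a `t`-ball inside the union of two non-parallel
  half-planes has its centre at level `≥ t/2` for one of them.

Sources: folklore plane geometry.  No proposition is defined and no named fact is introduced.
-/

noncomputable section

open scoped ComplexConjugate Topology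
open Set Metric Filter
open Literature.Probability.LatticeModels
open Summit.CriticalPhenomena.SAWScalingLimit.Theorems.PolygonParitySqueeze.InnerZigzag
  (level_split level_add_smul halfPlane_eq_of_level_eq_zero)

namespace Summit.CriticalPhenomena.SAWScalingLimit.Theorems.PolygonParitySqueeze.ZigzagDiscretisation

/-! ### 1. Tables of the six inner normals -/

/-- **Inner products of the six inner normals**: `Re(n_k · conj n_k')` is `1` on the diagonal, `-1` for
the opposite pairs `{0,1}, {2,3}, {4,5}`, and `±1/2` otherwise. [folklore] -/
theorem inner_innerNormal (k k' : Fin 6) :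
    (innerNormal k * conj (innerNormal k')).re =
      (![![1, -1, -1/2, 1/2, 1/2, -1/2], ![-1, 1, 1/2, -1/2, -1/2, 1/2],
         ![-1/2, 1/2, 1, -1, 1/2, -1/2], ![1/2, -1/2, -1, 1, -1/2, 1/2],
         ![1/2, -1/2, 1/2, -1/2, 1, -1], ![-1/2, 1/2, -1/2, 1/2, -1, 1]] : Fin 6 → Fin 6 → ℝ) k k' := by
  have h3 : Real.sqrt 3 * Real.sqrt 3 = 3 := Real.mul_self_sqrt (by norm_num)
  fin_cases k <;> fin_cases k' <;> simp [innerNormal_eq, Complex.mul_re] <;> nlinarith [h3]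

/-- **Cross products of the six inner normals**: `Re(i n_k · conj n_k') = (√3/2)·C k k'` with
`C ∈ {0, ±1}`, zero exactly for the parallel pairs. [folklore] -/
theorem cross_innerNormal (k k' : Fin 6) :
    (Complex.I * innerNormal k * conj (innerNormal k')).re = Real.sqrt 3 / 2 *
      (![![0, 0, -1, 1, -1, 1], ![0, 0, 1, -1, 1, -1], ![1, -1, 0, 0, 1, -1],
         ![-1, 1, 0, 0, -1, 1], ![1, -1, -1, 1, 0, 0], ![-1, 1, 1, -1, 0, 0]] : Fin 6 → Fin 6 → ℝ) k k' := by
  have h3 : Real.sqrt 3 * Real.sqrt 3 = 3 := Real.mul_self_sqrt (by norm_num)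
  fin_cases k <;> fin_cases k' <;> simp [innerNormal_eq, Complex.mul_re, Complex.mul_im] <;> nlinarith [h3]

/-- The four cases for a pair of forms: equal, opposite normals (inner product `-1`), or at
`60°`/`120°` (inner product `±1/2`, cross product `±√3/2`). [folklore] -/
theorem inner_innerNormal_cases (k k' : Fin 6) :
    ((innerNormal k * conj (innerNormal k')).re = 1 ∧ k = k') ∨
    (innerNormal k * conj (innerNormal k')).re = -1 ∨
    (((innerNormal k * conj (innerNormal k')).re = 1/2 ∨ (innerNormal k * conj (innerNormal k')).re = -1/2) ∧
      ((Complex.I * innerNormal k * conj (innerNormal k')).re = Real.sqrt 3 / 2 ∨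
        (Complex.I * innerNormal k * conj (innerNormal k')).re = -(Real.sqrt 3 / 2))) := by
  rw [inner_innerNormal, cross_innerNormal]
  fin_cases k <;> fin_cases k' <;> norm_num

/-- Opposite normals: inner product `-1` means `n_k' = -n_k`. [folklore] -/
theorem innerNormal_eq_neg_of_inner (k k' : Fin 6) (h : (innerNormal k * conj (innerNormal k')).re = -1) :
    innerNormal k' = -innerNormal k := by
  rw [inner_innerNormal] at h
  fin_cases k <;> fin_cases k' <;> norm_num at h <;> simp [innerNormal_eq]

/-- Distinct forms have inner product `≤ 1/2`. [folklore] -/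
theorem inner_innerNormal_le_half {k k' : Fin 6} (h : k ≠ k') :
    (innerNormal k * conj (innerNormal k')).re ≤ 1 / 2 := by
  rcases inner_innerNormal_cases k k' with ⟨-, h1⟩ | h1 | ⟨h1 | h1, -⟩
  · exact absurd h1 h
  all_goals linarith

/-- The inner product is symmetric. [folklore] -/
theorem inner_innerNormal_comm (k k' : Fin 6) :
    (innerNormal k' * conj (innerNormal k)).re = (innerNormal k * conj (innerNormal k')).re := by
  rw [← Complex.conj_re (innerNormal k' * conj (innerNormal k)), map_mul, Complex.conj_conj, mul_comm]

/-- `conj n_k · n_k = 1`. [folklore] -/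
theorem conj_innerNormal_mul_self (k : Fin 6) : conj (innerNormal k) * innerNormal k = 1 := by
  rw [mul_comm, Complex.mul_conj, Complex.normSq_eq_norm_sq, norm_innerNormal]; norm_num

/-! ### 2. Levels: continuity, Lipschitz bounds, decomposition along a line -/

/-- The level against `n_k` from the base point `z` is continuous. [folklore] -/
theorem continuous_level (k : Fin 6) (z : ℂ) : Continuous fun w : ℂ => ((w - z) * conj (innerNormal k)).re := by
  fun_prop

/-- The half-planes `halfPlane k z` are open. [folklore] -/
theorem isOpen_halfPlane (k : Fin 6) (z : ℂ) : IsOpen (halfPlane k z) :=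
  isOpen_lt continuous_const (continuous_level k z)

/-- Levels are `1`-Lipschitz in the point: `|level(w) - level(w')| ≤ dist w w'`. [folklore] -/
theorem abs_level_sub_level_le (k : Fin 6) (z w w' : ℂ) :
    |((w - z) * conj (innerNormal k)).re - ((w' - z) * conj (innerNormal k)).re| ≤ dist w w' := by
  rw [level_split (innerNormal k) w z w', add_sub_cancel_right]
  exact abs_level_le_dist k w' w

/-- Moving by `t·n_j` changes the level against `n_k` by `t·Re(n_j conj n_k)`. [folklore] -/
theorem level_add_real_mul_innerNormal (k j : Fin 6) (z w : ℂ) (t : ℝ) :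
    ((w + (t : ℂ) * innerNormal j - z) * conj (innerNormal k)).re =
      ((w - z) * conj (innerNormal k)).re + t * (innerNormal j * conj (innerNormal k)).re := by
  have : (w + (t : ℂ) * innerNormal j - z) * conj (innerNormal k) =
      (w - z) * conj (innerNormal k) + (t : ℂ) * (innerNormal j * conj (innerNormal k)) := by ring
  rw [this, Complex.add_re, Complex.re_ofReal_mul]

/-- Moving by `t·n_k` raises the level against `n_k` by `t`. [folklore] -/
theorem level_add_real_mul_innerNormal_self (k : Fin 6) (z w : ℂ) (t : ℝ) :
    ((w + (t : ℂ) * innerNormal k - z) * conj (innerNormal k)).re = ((w - z) * conj (innerNormal k)).re + t := by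
  rw [level_add_real_mul_innerNormal, re_innerNormal_mul_conj, mul_one]

/-- **A point at level `0` lies on the line**: `w - c = (i·b)·n_k` with `b = Im((w - c) conj n_k)` and
`‖w - c‖ = |b|`. [folklore] -/
theorem eq_of_level_eq_zero (k : Fin 6) {c w : ℂ} (h : ((w - c) * conj (innerNormal k)).re = 0) :
    w - c = (Complex.I * (((w - c) * conj (innerNormal k)).im : ℝ)) * innerNormal k ∧
      ‖w - c‖ = |((w - c) * conj (innerNormal k)).im| := by
  have key : w - c = ((w - c) * conj (innerNormal k)) * innerNormal k := by
    rw [mul_assoc, conj_innerNormal_mul_self, mul_one]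
  have hre : (w - c) * conj (innerNormal k) = Complex.I * (((w - c) * conj (innerNormal k)).im : ℝ) := by
    apply Complex.ext
    · simp [h]
    · simp
  refine ⟨by rw [← hre]; exact key, ?_⟩
  conv_lhs => rw [key, hre]
  rw [norm_mul, norm_mul, norm_innerNormal, Complex.norm_I, Complex.norm_real, Real.norm_eq_abs]
  ring

/-- **On the line of form `k` through `c`, the level of a non-parallel form `k'` is `±(√3/2)·‖w - c‖`.**
[folklore] -/
theorem abs_level_of_level_eq_zero (k k' : Fin 6) {c w : ℂ} (h : ((w - c) * conj (innerNormal k)).re = 0)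
    (hc : (Complex.I * innerNormal k * conj (innerNormal k')).re = Real.sqrt 3 / 2 ∨
      (Complex.I * innerNormal k * conj (innerNormal k')).re = -(Real.sqrt 3 / 2)) :
    |((w - c) * conj (innerNormal k')).re| = Real.sqrt 3 / 2 * ‖w - c‖ := by
  obtain ⟨hw, hn⟩ := eq_of_level_eq_zero k h
  set b : ℝ := ((w - c) * conj (innerNormal k)).im
  have : ((w - c) * conj (innerNormal k')).re = b * (Complex.I * innerNormal k * conj (innerNormal k')).re := by
    rw [hw]
    have e : Complex.I * (b : ℂ) * innerNormal k * conj (innerNormal k') =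
        (b : ℂ) * (Complex.I * innerNormal k * conj (innerNormal k')) := by ring
    rw [e, Complex.re_ofReal_mul]
  rw [this, hn, abs_mul]
  have h3 : 0 ≤ Real.sqrt 3 / 2 := by positivity
  rcases hc with hc | hc <;> rw [hc]
  · rw [abs_of_nonneg h3]; ring
  · rw [abs_neg, abs_of_nonneg h3]; ring

/-! ### 3. Chart uniqueness -/

/-- **Chart uniqueness**: if the half-ball of form `k` at `z` lies in the half-plane of form `k'`
through `z`, then `k = k'` (test point `z + (R/4)(n_k - n_k')`). [folklore] -/
theorem eq_of_halfPlane_inter_ball_subset {k k' : Fin 6} {z : ℂ} {R : ℝ} (hR : 0 < R)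
    (h : halfPlane k z ∩ ball z R ⊆ halfPlane k' z) : k = k' := by
  by_contra hne
  have hg := inner_innerNormal_le_half hne
  set w : ℂ := z + ((R / 4 : ℝ) : ℂ) * (innerNormal k - innerNormal k') with hw
  have hlev : ∀ j : Fin 6, ((w - z) * conj (innerNormal j)).re =
      R / 4 * ((innerNormal k * conj (innerNormal j)).re - (innerNormal k' * conj (innerNormal j)).re) := by
    intro j
    have : (w - z) * conj (innerNormal j) =
        ((R / 4 : ℝ) : ℂ) * (innerNormal k * conj (innerNormal j) - innerNormal k' * conj (innerNormal j)) := by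
      rw [hw]; ring
    rw [this, Complex.re_ofReal_mul, Complex.sub_re]
  have hmem : w ∈ halfPlane k z ∩ ball z R := by
    refine ⟨?_, ?_⟩
    · rw [mem_halfPlane_iff_level, hlev k, re_innerNormal_mul_conj, inner_innerNormal_comm]
      nlinarith
    · rw [mem_ball, dist_eq_norm, show w - z = ((R / 4 : ℝ) : ℂ) * (innerNormal k - innerNormal k') by
        rw [hw]; ring, norm_mul, Complex.norm_real, Real.norm_of_nonneg (by positivity)]
      have : ‖innerNormal k - innerNormal k'‖ ≤ 2 := by
        calc ‖innerNormal k - innerNormal k'‖ ≤ ‖innerNormal k‖ + ‖innerNormal k'‖ := norm_sub_le _ _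
          _ = 2 := by rw [norm_innerNormal, norm_innerNormal]; norm_num
      nlinarith
  have := (mem_halfPlane_iff_level k' z w).1 (h hmem)
  rw [hlev k', re_innerNormal_mul_conj] at this
  nlinarith

/-- Chart uniqueness, equality form. [folklore] -/
theorem eq_of_halfPlane_inter_ball_eq {k k' : Fin 6} {z : ℂ} {R : ℝ} (hR : 0 < R)
    (h : halfPlane k z ∩ ball z R = halfPlane k' z ∩ ball z R) : k = k' :=
  eq_of_halfPlane_inter_ball_subset hR fun _ hw => (h.subset hw).1

/-- Restricting a chart to a smaller ball. [folklore] -/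
theorem inter_eq_inter_of_subset {S Q B B' : Set ℂ} (h : S ∩ B = Q ∩ B) (hB : B' ⊆ B) :
    S ∩ B' = Q ∩ B' := by
  calc S ∩ B' = S ∩ B ∩ B' := by rw [inter_assoc, inter_eq_right.2 hB]
    _ = Q ∩ B ∩ B' := by rw [h]
    _ = Q ∩ B' := by rw [inter_assoc, inter_eq_right.2 hB]

/-! ### 4. Balls inside corner models -/

/-- A ball inside the upper half-plane above `x` has its centre at height `≥` its radius. [folklore] -/
theorem im_ge_of_ball_subset_upper {x p : ℂ} {s : ℝ} (hs : 0 < s)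
    (h : ball p s ⊆ {w : ℂ | x.im < w.im}) : x.im + s ≤ p.im := by
  have h' : ball p s ⊆ halfPlane 0 x := by rw [halfPlane_zero]; exact h
  have := level_ge_of_ball_subset 0 x p s hs h'
  rw [show ((p - x) * conj (innerNormal 0)).re = p.im - x.im by simp [innerNormal_eq]] at this
  linarith

/-- **LEMMA U**: a ball of radius `t` inside the union of two non-parallel half-planes through `c` has
its centre at level `≥ t/2` against one of the two normals (otherwise `y - λ(n_k + n_k')` leaves the
union inside the ball). [folklore] -/
theorem level_ge_or_of_ball_subset_union (k k' : Fin 6) (c y : ℂ) {t : ℝ} (ht : 0 < t)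
    (hg : (innerNormal k * conj (innerNormal k')).re = 1 / 2 ∨ (innerNormal k * conj (innerNormal k')).re = -1 / 2)
    (h : ball y t ⊆ halfPlane k c ∪ halfPlane k' c) :
    t / 2 ≤ ((y - c) * conj (innerNormal k)).re ∨ t / 2 ≤ ((y - c) * conj (innerNormal k')).re := by
  by_contra hcon
  push Not at hcon
  obtain ⟨ha, hb⟩ := hcon
  set a := ((y - c) * conj (innerNormal k)).re with ha_def
  set b := ((y - c) * conj (innerNormal k')).re with hb_def
  set g := (innerNormal k * conj (innerNormal k')).re with hg_def
  set κ : ℝ := 1 + g with hκ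
  have hκpos : 0 < κ := by rcases hg with hg | hg <;> rw [hκ, hg] <;> norm_num
  have hκge : 1 / 2 ≤ κ := by rcases hg with hg | hg <;> rw [hκ, hg] <;> norm_num
  set M : ℝ := max (max a b) 0 with hM
  have hMa : a ≤ M := (le_max_left a b).trans (le_max_left _ _)
  have hMb : b ≤ M := (le_max_right a b).trans (le_max_left _ _)
  have hM0 : 0 ≤ M := le_max_right _ _
  have hMt : M < t / 2 := max_lt (max_lt ha hb) (by linarith)
  set s : ℂ := innerNormal k + innerNormal k' with hs
  have hsk : (s * conj (innerNormal k)).re = κ := by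
    rw [hs, add_mul, Complex.add_re, re_innerNormal_mul_conj, inner_innerNormal_comm, ← hg_def]
  have hsk' : (s * conj (innerNormal k')).re = κ := by
    rw [hs, add_mul, Complex.add_re, re_innerNormal_mul_conj, ← hg_def, hκ]; ring
  have hss : ‖s‖ ^ 2 = 2 * κ := by
    rw [← Complex.normSq_eq_norm_sq]
    have e : Complex.normSq s = (s * conj s).re := by rw [Complex.mul_conj, Complex.ofReal_re]
    rw [e, hs, map_add]
    have : (innerNormal k + innerNormal k') * (conj (innerNormal k) + conj (innerNormal k')) =
        innerNormal k * conj (innerNormal k) + innerNormal k' * conj (innerNormal k') +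
          (innerNormal k * conj (innerNormal k') + innerNormal k' * conj (innerNormal k)) := by ring
    rw [this]
    simp only [Complex.add_re]
    rw [re_innerNormal_mul_conj, re_innerNormal_mul_conj, inner_innerNormal_comm k k', ← hg_def, hκ]; ring
  -- the escape parameter
  set l : ℝ := (3 * M + t / 2) / (4 * κ) with hl
  have hl0 : 0 < l := by rw [hl]; positivity
  have hlκ : l * κ = (3 * M + t / 2) / 4 := by rw [hl]; field_simp
  have hlM : M < l * κ := by rw [hlκ]; linarith
  have hlt : (l * ‖s‖) ^ 2 < t ^ 2 := by
    rw [mul_pow, hss]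
    have h1 : l ^ 2 * (2 * κ) = (3 * M + t / 2) ^ 2 / (8 * κ) := by rw [hl]; field_simp; ring
    rw [h1, div_lt_iff₀ (by positivity)]
    have h2 : (3 * M + t / 2) ^ 2 < 4 * t ^ 2 := by nlinarith
    nlinarith [sq_nonneg t]
  have hdist : dist (y - (l : ℂ) * s) y < t := by
    rw [dist_eq_norm, sub_sub_cancel_left, norm_neg, norm_mul, Complex.norm_real, Real.norm_of_nonneg hl0.le]
    have : 0 ≤ l * ‖s‖ := by positivity
    nlinarith
  have hmem := h (mem_ball.2 hdist)
  have hlev : ∀ n : ℂ, ((y - (l : ℂ) * s - c) * conj n).re = ((y - c) * conj n).re - l * (s * conj n).re := by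
    intro n
    have : (y - (l : ℂ) * s - c) * conj n = (y - c) * conj n - (l : ℂ) * (s * conj n) := by ring
    rw [this, Complex.sub_re, Complex.re_ofReal_mul]
  rcases hmem with hm | hm
  · rw [mem_halfPlane_iff_level, hlev, hsk, ← ha_def] at hm
    linarith
  · rw [mem_halfPlane_iff_level, hlev, hsk', ← hb_def] at hm
    linarith

/-- **LEMMA U** (registered form, sub-goal of `stub_innerPolygonsOfZigzag`): a ball of radius `t` inside
the union of two non-parallel zigzag half-planes through `c` has its centre at level `≥ t/2` against
one of them. [folklore] -/
theorem zd_ball_subset_union : ∀ (k k' : Fin 6) (c y : ℂ) (t : ℝ), 0 < t → ((innerNormal k * (starRingEnd ℂ) (innerNormal k')).re = 1 / 2 ∨ (innerNormal k * (starRingEnd ℂ) (innerNormal k')).re = -1 / 2) → Metric.ball y t ⊆ halfPlane k c ∪ halfPlane k' c → t / 2 ≤ ((y - c) * (starRingEnd ℂ) (innerNormal k)).re ∨ t / 2 ≤ ((y - c) * (starRingEnd ℂ) (innerNormal k')).re :=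
  fun k k' c y _ ht hg h => level_ge_or_of_ball_subset_union k k' c y ht hg h

end Summit.CriticalPhenomena.SAWScalingLimit.Theorems.PolygonParitySqueeze.ZigzagDiscretisation

end
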